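import Literature.MathematicalPhysics.QuantumFieldTheory.ConformalBootstrap3D.SingleCorrelatorNonVacuity
import Literature.MathematicalPhysics.QuantumFieldTheory.ConformalBootstrap3D.MeanFieldDecomposition
import Mathlib.Tactic
import HarnessLib

/-!
# Barrier (CriticalPhenomena / 3D Ising bootstrap enclosure): single-correlator certificates cannot isolate
# the Ising point from the free theory — no "island" from `⟨σσσσ⟩` alone

Barrier catalogue `Literature/Barriers/CriticalPhenomena/` (D-0021), for the certified-bootstrap programme
(pub-ising3d: typed axioms `SigmaEpsilonSystem`, certificate schema `SingleCorrelatorObligations`, hypothesis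
class `SigmaEpsilonData.SatisfiesSigmaAxioms` of `SingleCorrelatorNonVacuity`). The folklore seed "you need mixed
correlators to get an island" made precise from the printed sources and PROVED for the typed objects at the
free point.

- technique_class: SINGLE-CORRELATOR EXCLUSIONS — statements `SigmaBoxExcluded Q` ("no `σ–ε` datum whose
  `⟨σσσσ⟩` data satisfy sum rule 1 with genuine even-sector blocks, 3D unitarity bounds and even spins, and the
  even-scalar gap `Δ_{ε'} ≥ 3` of Kos–Poland–Simmons-Duffin 2014 §5.3 has `(Δ_σ, Δ_ε) ∈ Q`",
  `Literature.MathematicalPhysics.QuantumFieldTheory.ConformalBootstrap3D.SigmaBoxExcluded`; Lean class below: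
  `SingleCorrelatorCertifiable`). This contains every linear-functional certificate acting on the `⟨σσσσ⟩` sum rule
  — the method of Rattazzi–Rychkov–Tonni–Vichi 2008 §5 ("look for a linear functional … positive on all …
  F_{Δ,l} … If such a functional exists, the crossing relation cannot be satisfied") [cite: RattazziEtAl2008, §5]
  and of El-Showk et al. 2012 §5 [cite: ElShowkEtAl2012, §5] — in particular every point/derivative-functional
  certificate of the tree (`SingleCorrelatorObligations.sigmaBoxExcluded`) and of the SDP numerics restricted to
  `⟨σσσσ⟩`.
- blocks: any enclosure `SigmaIsingEnclosure W R` (every datum of the class with `(Δ_σ,Δ_ε) ∈ W` lies in `R`) whose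
  window `W` contains the free point `(1/2, 1)` and whose region `R` does not — i.e. an ISLAND around the Ising values
  `(Δ_σ, Δ_ε) = (0.5181489(10), 1.412625(10))` [cite: KosPolandSimmonsDuffinVichi2016, §1] obtained from `⟨σσσσ⟩`
  alone on a window reaching down to `Δ_σ = 1/2`; equivalently any `SigmaBoxExcluded Q` with `(1/2, 1) ∈ Q`
  (`singleCorrelator_not_excludes_freePoint`, `no_singleCorrelator_island`); and, column by column, any
  enclosure whose window contains a point `(p, 2p)`, `p > 1/2`, of the generalised-free ("gaussian") line and whose
  region does not — e.g. an island around the Ising values inside the Ising column `Δ_σ ∈ [0.5175, 0.5185]`, which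
  would have to exclude `(Δ_σ, 2Δ_σ) ≈ (0.518, 1.036)` (`singleCorrelator_not_excludes_gffLine`,
  `no_singleCorrelator_island_in_column`, `not_sigmaIsingEnclosure_isingColumnIsland`).
- because: the free massless scalar `σ = φ`, `ε = φ²`, `(Δ_σ, Δ_ε) = (1/2, 1)`, satisfies every hypothesis the
  technique class may use — a THEOREM about the typed objects: the conformal block decomposition
  `𝒢 − 1 = Σ_m λ²_{2m} g_{2m+1,2m}` of the free four-point function into the tree's genuine 3D blocks
  (`FreeScalarBlockDecomposition.hasSum_freeScalar_blocks`, coefficients = the mean-field values of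
  [cite: FitzpatrickKaplan2012, §2.2] at `Δ_φ = 1/2`), hence `freeScalarData_satisfiesSigmaAxioms` and
  `SigmaBoxExcluded.half_one_not_mem` [cite: ElShowkEtAl2012, §5] ("the curve bounding the allowed region starts
  at the free theory point"; with `Δ_{ε'} > Δ_*` "the gaussian line `Δ_ε = 2Δ_σ`" is excluded only "up to a
  dimension of `Δ_σ = Δ_*/2 − 1`, since the spectrum of this solution is `2Δ_σ + 2n + l`" — for `Δ_* = 3` not at
  all above `Δ_σ = 1/2`); and likewise the generalised free scalar of every dimension `p > 1/2`
  (`σ = φ`, `ε = φ²`, `(Δ_σ, Δ_ε) = (p, 2p)`, spectrum `2p + 2n + ℓ`, squared OPE coefficients `2 P_{n,ℓ}(p)` of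
  [cite: FitzpatrickKaplan2012, §2.2]) — again a THEOREM about the typed objects: the mean-field block
  decomposition `u^p + (u/v)^p = Σ_{n,m} 2 P_{n,2m}(p) g_{2p+2n+2m,2m}` (`MeanFieldDecomposition.hasSum_gff_blocks`,
  proved by the Casimir-pair closure of `MeanFieldSources`), hence `gffData_satisfiesSigmaAxioms` and
  `SigmaBoxExcluded.gff_not_mem`.
- evasions_known: the MIXED system `{⟨σσσσ⟩, ⟨σσεε⟩, ⟨εεεε⟩}` with the ODD-sector gap `Δ_{σ'} ≥ 3` (the free field
  has `σ³` at `3Δ_σ = 3/2 < 3` and is excluded): "a small closed region around the Ising point"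
  [cite: KosPolandSimmonsduffin2014, §5.3] [cite: KosPolandSimmonsDuffinVichi2016, §1]; within `⟨σσσσ⟩`, stronger
  even-sector gaps `Δ_{ε'} ≥ 3.4, 3.8` carve "an allowed region with two branches" but still one "terminates near
  the free theory" [cite: ElShowkEtAl2012, §5]; windows `W` bounded away from the free point / the gaussian line
  (the form of every landed single-correlator theorem of the tree, e.g. `PointKernelSigma.sigmaIsingEnclosure_K34_column`:
  a column `0.5175 ≤ Δ_σ ≤ 0.5185 ⇒ Δ_ε < 1.6`, an upper curve, not an island).
- scope_caveats: PROVED at the free point `(1/2, 1)` AND on the whole gaussian line `Δ_ε = 2Δ_σ`, `Δ_σ > 1/2`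
  (so that no column `Δ_σ ∈ [a, b]`, `a > 1/2`, can exclude a band around `2Δ_σ`; numerically this is what
  El-Showk et al. 2012 Fig. 3 and the pub-ising3d `Λ = 11` box map show); NOT covered: points strictly between the
  gaussian line and the single-correlator bound (no datum of the class is exhibited there by the tree), and the
  barrier concerns the hypothesis class `SatisfiesSigmaAxioms` exactly as typed (sum rule 1, A1, A2, A4(b)) —
  adding hypotheses on `⟨σσσσ⟩` beyond these (a stress-tensor/central-charge input, a twist gap, `Δ_{ε'} > 3`;
  note the gaussian line has `ε' = [σσ]_{1,0}` at `2Δ_σ + 2 < 3.04` in the Ising column, so `Δ_{ε'} ≥ 3.4` does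
  remove it there [cite: ElShowkEtAl2012, §5]) is not covered; nothing is said about non-rigorous spectrum extraction.
- status: established (theorem, proved below from `SingleCorrelatorNonVacuity` and `MeanFieldDecomposition`; the
  physics statements quoted are the cited papers').
-/

namespace Literature.Barriers.CriticalPhenomena

open Set Literature.MathematicalPhysics.QuantumFieldTheory.ConformalBootstrap3D

/-- **Technique class**: a region `Q ⊆ (Δ_σ, Δ_ε)`-plane is *single-correlator certifiable* if it is excluded
over the single-correlator hypothesis class — `SigmaBoxExcluded Q`: no `σ–ε` datum satisfying
`SatisfiesSigmaAxioms` (genuine even-sector blocks, unitarity bounds and even spins, diagonal OPE convergence,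
sum rule 1, the even-scalar gap) has `(Δ_σ, Δ_ε) ∈ Q`. Every functional certificate acting on the `⟨σσσσ⟩` sum
rule proves statements of exactly this form (`SingleCorrelatorObligations.sigmaBoxExcluded`).
[cite: RattazziEtAl2008, §5] -/
def SingleCorrelatorCertifiable (Q : Set (ℝ × ℝ)) : Prop :=
  SigmaBoxExcluded Q

/-- The technique class is literally `SigmaBoxExcluded`. [folklore] -/
theorem singleCorrelatorCertifiable_iff (Q : Set (ℝ × ℝ)) :
    SingleCorrelatorCertifiable Q ↔ SigmaBoxExcluded Q := Iff.rfl

/-- Every point-functional certificate of the tree's schema lands in the technique class.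
[cite: KosPolandSimmonsduffin2014, §3.3 eq. (3.16)] -/
theorem SingleCorrelatorCertifiable.of_obligations {n : ℕ} {w z zb : Fin n → ℝ}
    (hz : ∀ k, z k ∈ Ioo (0 : ℝ) 1) (hzb : ∀ k, zb k ∈ Ioo (0 : ℝ) 1) {Q : Set (ℝ × ℝ)} {Δstar : ℝ}
    (h : SingleCorrelatorObligations (pointFunctional w z zb) Q Δstar) :
    SingleCorrelatorCertifiable Q :=
  h.sigmaBoxExcluded hz hzb

/-- The class is monotone and closed under binary unions (certificates are assembled box by box).
[folklore] -/
theorem SingleCorrelatorCertifiable.mono {Q Q' : Set (ℝ × ℝ)} (h : SingleCorrelatorCertifiable Q)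
    (hQ' : Q' ⊆ Q) : SingleCorrelatorCertifiable Q' :=
  SigmaBoxExcluded.mono h hQ'

/-- Binary unions. [folklore] -/
theorem SingleCorrelatorCertifiable.union {Q Q' : Set (ℝ × ℝ)} (h : SingleCorrelatorCertifiable Q)
    (h' : SingleCorrelatorCertifiable Q') : SingleCorrelatorCertifiable (Q ∪ Q') :=
  SigmaBoxExcluded.union h h'

/-- **THE BARRIER.** No single-correlator certifiable region contains the free point `(Δ_σ, Δ_ε) = (1/2, 1)`:
the free massless scalar (`σ = φ`, `ε = φ²`) realises the hypothesis class
(`freeScalarData_satisfiesSigmaAxioms`, from the proved block decomposition `hasSum_freeScalar_blocks`).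
[cite: ElShowkEtAl2012, §5] -/
theorem singleCorrelator_not_excludes_freePoint {Q : Set (ℝ × ℝ)} (h : SingleCorrelatorCertifiable Q) :
    ((1 : ℝ) / 2, (1 : ℝ)) ∉ Q :=
  SigmaBoxExcluded.half_one_not_mem h

/-- Equivalently: a region containing the free point is not single-correlator certifiable.
[cite: ElShowkEtAl2012, §5] -/
theorem not_singleCorrelatorCertifiable_of_mem {Q : Set (ℝ × ℝ)} (hQ : ((1 : ℝ) / 2, (1 : ℝ)) ∈ Q) :
    ¬ SingleCorrelatorCertifiable Q :=
  fun h => singleCorrelator_not_excludes_freePoint h hQ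

/-- **No island from `⟨σσσσ⟩`.** An enclosure over the single-correlator class, `SigmaIsingEnclosure W R` (every
datum of the class with `(Δ_σ, Δ_ε)` in the window `W` lies in `R`), whose window contains the free point must
keep the free point in `R`: it cannot be an island around the Ising values separating them from `(1/2, 1)`.
[cite: KosPolandSimmonsduffin2014, §5.3] -/
theorem no_singleCorrelator_island {W R : Set (ℝ × ℝ)} (h : SigmaIsingEnclosure W R)
    (hW : ((1 : ℝ) / 2, (1 : ℝ)) ∈ W) (hR : ((1 : ℝ) / 2, (1 : ℝ)) ∉ R) : False :=
  hR (h.half_one_mem hW)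

/-- The covering form used by certificate assemblies: if a window `W ∋ (1/2, 1)` is covered by `R` and finitely or
infinitely many single-correlator certifiable boxes `Q i`, then `(1/2, 1) ∈ R` — the boxes can never eat the free
point. [cite: ElShowkEtAl2012, §5] -/
theorem freePoint_mem_of_cover {ι : Type*} {W R : Set (ℝ × ℝ)} (Q : ι → Set (ℝ × ℝ))
    (hQ : ∀ i, SingleCorrelatorCertifiable (Q i)) (hcover : W ⊆ R ∪ ⋃ i, Q i)
    (hW : ((1 : ℝ) / 2, (1 : ℝ)) ∈ W) : ((1 : ℝ) / 2, (1 : ℝ)) ∈ R :=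
  (sigmaIsingEnclosure_of_cover Q hcover hQ).half_one_mem hW

/-- **Concrete instance**: the box `[0.51, 0.53] × [1.40, 1.43]` around the Ising values
`(0.5181489, 1.412625)` [cite: KosPolandSimmonsDuffinVichi2016, §1] is not the region of any single-correlator
enclosure on a window containing the free point — e.g. on `W = [1/2, 0.53] × [1/2, 2]`. [cite: KosPolandSimmonsduffin2014, §5.3] -/
theorem not_sigmaIsingEnclosure_isingBox :
    ¬ SigmaIsingEnclosure (Icc ((1 : ℝ) / 2) 0.53 ×ˢ Icc ((1 : ℝ) / 2) 2)
        (Icc (0.51 : ℝ) 0.53 ×ˢ Icc (1.40 : ℝ) 1.43) := by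
  intro h
  refine no_singleCorrelator_island h ?_ ?_
  · refine ⟨⟨le_rfl, by norm_num⟩, by norm_num, by norm_num⟩
  · intro hmem
    have h1 : (0.51 : ℝ) ≤ 1 / 2 := hmem.1.1
    norm_num at h1

/-! ### The gaussian line: the barrier in every column `Δ_σ = p > 1/2` -/

/-- **THE BARRIER ON THE GAUSSIAN LINE.** No single-correlator certifiable region contains a point
`(Δ_σ, Δ_ε) = (p, 2p)` with `p > 1/2`: the generalised free scalar of dimension `p` (`σ = φ`, `ε = φ²`) realises the
hypothesis class (`gffData_satisfiesSigmaAxioms`, from the proved mean-field block decomposition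
`hasSum_gff_blocks`). [cite: ElShowkEtAl2012, §5] -/
theorem singleCorrelator_not_excludes_gffLine {Q : Set (ℝ × ℝ)} (h : SingleCorrelatorCertifiable Q) {p : ℝ}
    (hp : 1 / 2 < p) : (p, 2 * p) ∉ Q :=
  SigmaBoxExcluded.gff_not_mem h hp

/-- Equivalently: a region meeting the gaussian line above `Δ_σ = 1/2` is not single-correlator certifiable.
[cite: ElShowkEtAl2012, §5] -/
theorem not_singleCorrelatorCertifiable_of_gff_mem {Q : Set (ℝ × ℝ)} {p : ℝ} (hp : 1 / 2 < p)
    (hQ : (p, 2 * p) ∈ Q) : ¬ SingleCorrelatorCertifiable Q :=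
  fun h => singleCorrelator_not_excludes_gffLine h hp hQ

/-- **No island in any column.** An enclosure over the single-correlator class whose window contains a point
`(p, 2p)`, `p > 1/2`, must keep it in its region: inside a column `Δ_σ ∈ [a, b]` (`a > 1/2`) reaching down to
`Δ_ε ≤ 2a`, single-correlator certificates cannot produce a region bounded away from `Δ_ε = 2Δ_σ`.
[cite: KosPolandSimmonsduffin2014, §5.3] -/
theorem no_singleCorrelator_island_in_column {W R : Set (ℝ × ℝ)} (h : SigmaIsingEnclosure W R) {p : ℝ}
    (hp : 1 / 2 < p) (hW : (p, 2 * p) ∈ W) (hR : (p, 2 * p) ∉ R) : False :=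
  hR (h.gff_mem hp hW)

/-- The covering form: if a window `W ∋ (p, 2p)` (`p > 1/2`) is covered by `R` and single-correlator certifiable
boxes, then `(p, 2p) ∈ R`. [cite: ElShowkEtAl2012, §5] -/
theorem gffPoint_mem_of_cover {ι : Type*} {W R : Set (ℝ × ℝ)} (Q : ι → Set (ℝ × ℝ))
    (hQ : ∀ i, SingleCorrelatorCertifiable (Q i)) (hcover : W ⊆ R ∪ ⋃ i, Q i) {p : ℝ} (hp : 1 / 2 < p)
    (hW : (p, 2 * p) ∈ W) : (p, 2 * p) ∈ R :=
  (sigmaIsingEnclosure_of_cover Q hcover hQ).gff_mem hp hW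

/-- **Concrete instance (the Ising column).** On the window `W = [0.5175, 0.5185] × [1/2, 2]` — the `Δ_σ`-column of
the tree's single-correlator theorems (`PointKernelSigma.sigmaIsingEnclosure_K34_column`), which does NOT contain the
free point — the box `[0.5175, 0.5185] × [1.40, 1.43]` around the Ising values `(0.5181489, 1.412625)`
[cite: KosPolandSimmonsDuffinVichi2016, §1] is not the region of any single-correlator enclosure: the gaussian point
`(0.518, 1.036)` lies in the window. [cite: KosPolandSimmonsduffin2014, §5.3] -/
theorem not_sigmaIsingEnclosure_isingColumnIsland :
    ¬ SigmaIsingEnclosure (Icc (0.5175 : ℝ) 0.5185 ×ˢ Icc ((1 : ℝ) / 2) 2)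
        (Icc (0.5175 : ℝ) 0.5185 ×ˢ Icc (1.40 : ℝ) 1.43) := by
  intro h
  refine no_singleCorrelator_island_in_column h (p := 0.518) (by norm_num) ?_ ?_
  · refine ⟨⟨by norm_num, by norm_num⟩, by norm_num, by norm_num⟩
  · intro hmem
    have h1 : (1.40 : ℝ) ≤ 2 * 0.518 := hmem.2.1
    norm_num at h1

end Literature.Barriers.CriticalPhenomena
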